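import Summits.QuantumFields.BalabanUV.T4Continuum.Support.NE9ChannelSum
import Summits.QuantumFields.BalabanUV.T4Continuum.Support.NE9MarginalProjectionEnd

/-!
# NE9ChannelSumMargProj — crew row (w25), the END-OF-RECORD half: the NE9 END faces ON THE v1.3 DICTIONARY (`…_compProj` /
# `…_margProj` of `NE9MarginalProjectionEnd`, the END of record p208940) AT THE ASSEMBLED CHANNEL `T_a + T_b`, with the S-binders
# and the profile assembled by leaf-07-g5's `NE9ChannelSum` (p214415) BY NAME and the one ingredient that face does not need but
# END-M does — the COUPLING MODULUS (leaf A3's `hTcup`) of a sum of channels — supplied here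
# (cell `pub-balaban`, T4-DAG §2 node U3 / §6 NE9; NE9 formalisation swarm, unit `b2b-balaban-t4-ne9-formalise-leaf-04` gen 6 —
# crew row (w25) of the owner g25's list, journal l.10121; CLAIM l.10270 (this seat, 09:41:59Z) / l.10277 (leaf-07-g5, 09:42:18Z,
# LANDED p214415 first): double claim resolved by SPLITTING — leaf-07-g5 = the S-binder algebra + the d-currency E5′ face,
# this file = the END-M faces + `tcup`; nothing of p214415 is restated)

HONEST FRAMING (T4-DAG PAGE 1).  Rung (B)+1 of the FINITE-VOLUME T⁴ programme — NOT infinite volume, NOT a mass gap, NOT the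
Clay problem.  NE9 (`T4OutputRate.NE9` ∧ `FadingMemory`) is a cell NEW ESTIMATE, NOT PRINTED, NOT discharged here; spine 0/9;
0/18 skeleton leaves instantiated on Bałaban's objects (O-NE9-1).  HONEST DEPENDENCY (cell line, verbatim): continuum YM on T⁴
⇐ BetaPertH ∧ nine spine estimates (0/9 proved); BetaPertH ⇐ (D1) ∧ (D4) ∧ CAP+tail; G-an2-4 gates asym, D1 and NE2/3/4.
`FlowStep.BetaPertH`, (B), (B^μ) do not occur.  [I] = [Balaban1987RG1] (CMP **109**), [II] = [Balaban1988RG2Cluster]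
(CMP **116**) are quoted for TYPES only (ABSOLUTE RULE: nothing printed in the audited series is asserted).

WHERE THIS SITS.  The NE9 END of record reads the history channel on the PROJECTED old terms, `T := 𝒯 ∘ P` (`NE9MarginalProjection
.compProj`; `P := margProj r A` re-attaches the counterterm of [I] (1.3) p. 260), and consumes `𝒯` through `ChannelAdditive MF 𝒯`,
`ChannelStepSum MF 𝒯`, `ChannelSizeAtStepNN MF 𝒯 κ wt τ`, a profile `τ k j ≤ τ̄·ω^{k−j}`, and leaf A3's coupling modulus `hTcup` in
the weighted form `wt k y · (qT k · |g_k − g′_k|)`.  In print the localized curly bracket (1.33) p. 9 of [II] sums the (1.23)-pieces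
of ALL the terms of the fundamental expansion [I] (3.34) p. 277 — the fifth-order remainder (species (a), `NE9Lemma1CurveSpecies`)
and the point-localized orders 2–4 ([I] §4; species (b), `NE9Lemma1KernelSpecies`) —, so the frame's channel is a SUM `T_a + T_b`
of species channels.  leaf-07-g5's `NE9ChannelSum` (p214415) proved that the S-binders are closed under such sums under a COMMON
dominating output weight (`channelAdditive_add`, `channelStepSum_add`, `channelSizeAtStepNN_add`), that the profile of a sum fades
at the SLOWER rate with the constants ADDED (`profile_add`: `(τ_a + τ_b) k j ≤ (τ̄_a + τ̄_b)·(max ω_a ω_b)^{k−j}`), and stated the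
d-currency face E5′ at the sum.  THIS FILE adds:
* §1 `compProj_add` (`(T_a + T_b) ∘ P = T_a ∘ P + T_b ∘ P`, definitional) and **`tcup_add`**: the coupling moduli of the summands,
  `|Tᵢ(g) − Tᵢ(g′)| ≤ wtᵢ·(qTᵢ·|g_k − g′_k|)` with `wtᵢ ≤ wt`, give `|(T_a + T_b)(g) − (T_a + T_b)(g′)| ≤ wt·((qT_a + qT_b)·|g_k − g′_k|)`
  (triangle inequality; the A3 producers per species — A3-REM/(w20) — plug in BY NAME);
* §2 **`termSize_ne9_and_fadingMemory_compProj_sum`**: END-M's `…_compProj` face APPLIED BY NAME at `𝒯 := T_a + T_b`, `τ := τ_a +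
  τ_b`, `ω := max ω_a ω_b`, `τbar := τ̄_a + τ̄_b`, `qTbar := q̄_a + q̄_b`, with the sum's S-binders from p214415 §1, its profile from
  p214415 §2 and its coupling modulus from §1 here — displayed PER SUMMAND: `haddᵢ hsumᵢ hstepᵢ hτᵢ hTcupᵢ` + the weight dominations
  `hwa hwb`; every other binder END-M's VERBATIM (projection binders, factorisation and box at the sum, activity two-point data, KP,
  geometry, sizes); and **`termSize_ne9_and_fadingMemory_margProj_sum`**, the same through END-M's `…_margProj` (RO/AW binders,
  `ProjInto` displayed — for classes of ANALYTIC families it is `NE9RemainderSpeciesMargProj.projInto_margProj_analytic`, p213217 §2).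
INSTANCES (not here; one-liners BY NAME once the producers are in the tree): species (a) ⊕ (b) with `hstepa := channelSizeAtStepNN_cur`
(p213869), `hstepb := channelSizeAtStepNN_ker` (p214232), `hadd·` from (w19)/(w23), `hTcup·` from (w20); common weight by
`NE9ChannelSum.channelSizeAtStepNN_add_cpiece` / `weightOf_mono` when the two frames share d_k(Y).  DISGUISE TEST: the triangle
inequality + the END applied by name — no history comparison is proved here; not NE9; that Bałaban's (1.33) IS this sum is O-NE9-1.

References (TYPES only): [Balaban1987RG1] T. Bałaban, *Renormalization group approach to lattice gauge field theories. I*,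
Commun. Math. Phys. **109** (1987) 249–301 — (0.28)–(0.30) p. 258, (1.3) p. 260, (1.18) p. 263, (1.20)–(1.22) p. 264, (2.12)–
(2.14) p. 268, (3.34) p. 277, p. 288; [Balaban1988RG2Cluster] T. Bałaban, *… II. Cluster expansions*, Commun. Math. Phys. **116**
(1988) 1–22 — (1.23)–(1.29) pp. 7–8, (1.33)–(1.36) p. 9, (2.14)–(2.15) p. 15.  Summits-side NEW work (LEAN PLACEMENT RULE); imports
`NE9ChannelSum` (p214415, leaf-07-g5) + `NE9MarginalProjectionEnd` BY NAME; modifies nothing; 0 sorry; 0 `def`.  Value =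
bookkeeping: the END of record consumes a sum of species channels with added letters at the slower rate, NOT summit progress.
-/

noncomputable section

namespace Summit.QuantumFields.BalabanUV.T4Continuum.NE9ChannelSumMargProj

open scoped BigOperators
open Literature.Probability.LatticeModels
open Literature.MathematicalPhysics.QuantumFieldTheory.Balaban1983to89
open Literature.MathematicalPhysics.QuantumFieldTheory.Balaban1983to89.T4OutputRate
open Literature.MathematicalPhysics.QuantumFieldTheory.Balaban1983to89.T4HistoryLipschitzRecursion
open Literature.MathematicalPhysics.QuantumFieldTheory.Balaban1983to89.T4HistoryLipschitzOuter
open Literature.MathematicalPhysics.QuantumFieldTheory.Balaban1983to89.T4HistoryLipschitzActivity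
open Literature.MathematicalPhysics.QuantumFieldTheory.Balaban1983to89.T4HistoryLipschitzActivity (ClusterGeom)
open Literature.MathematicalPhysics.QuantumFieldTheory.Balaban1983to89.T4HistoryLipschitzSegment
open Summit.QuantumFields.BalabanUV.T4Continuum.NE9BridgeSizeInduction
open Summit.QuantumFields.BalabanUV.T4Continuum.NE9MarginalProjection
open Summit.QuantumFields.BalabanUV.T4Continuum.NE9MarginalProjectionEnd
open Summit.QuantumFields.BalabanUV.T4Continuum.NE9ChannelSum

variable {C : Carriers} {Bg ι : Type}

/-! ## §1 Composition with a projection and the coupling modulus of a sum of channels -/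

section Sum

variable {Ta Tb : ℕ → (ℕ → ℝ) → (Bg → C.Dom → ℝ) → ι → ℝ}

/-- Composition with a projection of the old terms distributes over sums of channels (definitional):
`(T_a + T_b) ∘ P = T_a ∘ P + T_b ∘ P`. [cite: Balaban1987RG1, (1.3) p.260] -/
theorem compProj_add (P : (Bg → C.Dom → ℝ) → (Bg → C.Dom → ℝ)) : compProj (Ta + Tb) P = compProj Ta P + compProj Tb P := rfl

/-- **THE COUPLING MODULUS (leaf A3's `hTcup` shape) OF A SUM OF CHANNELS**: if `T_a`, `T_b` respond to the last coupling with
weighted moduli `wt_a·qT_a`, `wt_b·qT_b` and both weights are dominated by a COMMON output weight `wt` (the one R1's `hρ` and the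
box `hbox` consume), then `T_a + T_b` responds with `wt·(qT_a + qT_b)` — triangle inequality, `qT· ≥ 0`.
[cite: Balaban1988RG2Cluster, (2.14)-(2.15) p.15] -/
theorem tcup_add {E : Functional C Bg} {W : Set (ℕ → ℝ)} {wt wta wtb : ℕ → ι → ℝ} {qTa qTb : ℕ → ℝ}
    (ha : ∀ g ∈ W, ∀ g' ∈ W, ∀ (k : ℕ) (y : ι), |Ta k g (E g) y - Ta k g' (E g) y| ≤ wta k y * (qTa k * |g k - g' k|))
    (hb : ∀ g ∈ W, ∀ g' ∈ W, ∀ (k : ℕ) (y : ι), |Tb k g (E g) y - Tb k g' (E g) y| ≤ wtb k y * (qTb k * |g k - g' k|))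
    (hwa : ∀ k y, wta k y ≤ wt k y) (hwb : ∀ k y, wtb k y ≤ wt k y) (hqa : ∀ k, 0 ≤ qTa k) (hqb : ∀ k, 0 ≤ qTb k) :
    ∀ g ∈ W, ∀ g' ∈ W, ∀ (k : ℕ) (y : ι),
      |(Ta + Tb) k g (E g) y - (Ta + Tb) k g' (E g) y| ≤ wt k y * ((qTa + qTb) k * |g k - g' k|) := by
  intro g hg g' hg' k y
  have ea := ha g hg g' hg' k y
  have eb := hb g hg g' hg' k y
  have hΔ : 0 ≤ |g k - g' k| := abs_nonneg _
  have na : 0 ≤ qTa k * |g k - g' k| := mul_nonneg (hqa k) hΔ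
  have nb : 0 ≤ qTb k * |g k - g' k| := mul_nonneg (hqb k) hΔ
  simp only [Pi.add_apply]
  calc |Ta k g (E g) y + Tb k g (E g) y - (Ta k g' (E g) y + Tb k g' (E g) y)|
        = |(Ta k g (E g) y - Ta k g' (E g) y) + (Tb k g (E g) y - Tb k g' (E g) y)| := by ring_nf
    _ ≤ |Ta k g (E g) y - Ta k g' (E g) y| + |Tb k g (E g) y - Tb k g' (E g) y| := abs_add_le _ _
    _ ≤ wta k y * (qTa k * |g k - g' k|) + wtb k y * (qTb k * |g k - g' k|) := add_le_add ea eb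
    _ ≤ wt k y * (qTa k * |g k - g' k|) + wt k y * (qTb k * |g k - g' k|) :=
        add_le_add (mul_le_mul_of_nonneg_right (hwa k y) na) (mul_le_mul_of_nonneg_right (hwb k y) nb)
    _ = wt k y * ((qTa k + qTb k) * |g k - g' k|) := by ring

end Sum

/-! ## §2 The NE9 END faces of record for the assembled channel `T_a + T_b` -/

section End

/-- **THE NE9 END OF RECORD (`…_compProj` face) FOR THE ASSEMBLED CHANNEL `T_a + T_b`** — END-M's
`ne9_and_fadingMemory_of_couplingTwoPoint_vacSub_sizeInduction_compProj` APPLIED BY NAME at `𝒯 := T_a + T_b`, `τ := τ_a + τ_b`,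
`ω := max ω_a ω_b`, `τbar := τ̄_a + τ̄_b`, `qTbar := q̄_a + q̄_b`, with the sum's channel binders on the marginal-free class from
leaf-07-g5's `channelAdditive_add` / `channelStepSum_add` / `channelSizeAtStepNN_add` (common dominating weight `wt`), its profile
from `profile_add` (the assembled channel fades at the SLOWER of the two rate letters — [I] p. 288 *"the power 4 + β instead of
5"*, O-ne9p1g23-1) and its coupling modulus from §1 `tcup_add`.  DISPLAYED PER SUMMAND: `haddᵢ : ChannelAdditive MF Tᵢ`, `hsumᵢ`,
`hstepᵢ : ChannelSizeAtStepNN MF Tᵢ κ wtᵢ τᵢ`, the profiles `hτᵢ` (`τ̄ᵢ ≥ 0`, `0 < ω_a`, `0 ≤ ω_b`), leaf A3 `hTcupᵢ` at `Tᵢ ∘ P`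
(`0 ≤ qTᵢ ≤ q̄ᵢ`), the dominations `hwa hwb`; every other binder END-M's VERBATIM at the sum channel / sum letters.  Conclusion =
END-M's.  Instances: species (a) ⊕ (b) of [I] (3.34)/§4 by `channelSizeAtStepNN_cur` / `channelSizeAtStepNN_ker` — not here;
that Bałaban's (1.33) IS this sum is O-NE9-1, NOT claimed.
[cite: Balaban1987RG1, (1.3) p.260, (2.12)-(2.14) p.268, (3.34) p.277, p.288; Balaban1988RG2Cluster, (1.23)-(1.29) pp.7-8, (1.33)-(1.36) p.9, (2.14)-(2.15) p.15] -/
theorem termSize_ne9_and_fadingMemory_compProj_sum (G : ClusterGeom C) {Pot : Type*}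
    [NormedAddCommGroup Pot] [NormedSpace ℂ Pot] {E : Functional C Bg} {W : Set (ℕ → ℝ)} {Adm MF : Set (Bg → C.Dom → ℝ)}
    {P : (Bg → C.Dom → ℝ) → (Bg → C.Dom → ℝ)} {Ta Tb : ℕ → (ℕ → ℝ) → (Bg → C.Dom → ℝ) → ι → ℝ}
    {Ψ : ℕ → ℝ → (ι → ℝ) → Bg → C.Dom → ℝ} {act : ℕ → ℝ → Bg → Pot → G.P → ℂ} {𝒜 : ℕ → Set Pot}
    {n : ℕ → ℝ → Bg → G.P → ℝ} {lip clip : ℕ → ℝ} {a d : G.P → ℝ} {δ : C.Dom → ℝ}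
    {κ B lipbar clipbar qba qbb τba τbb ωa ωb c : ℝ} {wt wta wtb : ℕ → ι → ℝ} {τa τb : ℕ → ℕ → ℝ}
    {qTa qTb p₀ N : ℕ → ℝ}
    (ρ : ℕ → (ι → ℝ) → Pot) (U₀ : Bg) (explZ : ℕ → Bg → C.Dom → ℝ) (h0 : ScaleZeroFree E W)
    (hAdm : AdmissibleTerms E W Adm) (hres : AdmRestrict Adm)
    -- the projection binders (END-M, verbatim)
    (hPadd : ProjAdditive Adm P) (hPcomm : ProjScaleComm Adm P) (hPinto : ProjInto Adm MF P) (hPsize : ProjSize Adm P κ c)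
    (hc : 0 ≤ c)
    -- species (a): its channel's S-binders on the marginal-free class, profile and coupling modulus (displayed, as delivered)
    (hadda : ChannelAdditive MF Ta) (hsuma : ChannelStepSum MF Ta) (hstepa : ChannelSizeAtStepNN MF Ta κ wta τa)
    (hτa : ∀ k j, j ≤ k → 0 ≤ τa k j ∧ τa k j ≤ τba * ωa ^ (k - j)) (hτba : 0 ≤ τba) (hωa : 0 < ωa)
    (hqTa0 : ∀ k, 0 ≤ qTa k) (hqTab : ∀ k, qTa k ≤ qba)
    (hTcupa : ∀ g ∈ W, ∀ g' ∈ W, ∀ (k : ℕ) (y : ι),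
      |compProj Ta P k g (E g) y - compProj Ta P k g' (E g) y| ≤ wta k y * (qTa k * |g k - g' k|))
    -- species (b): likewise
    (haddb : ChannelAdditive MF Tb) (hsumb : ChannelStepSum MF Tb) (hstepb : ChannelSizeAtStepNN MF Tb κ wtb τb)
    (hτb : ∀ k j, j ≤ k → 0 ≤ τb k j ∧ τb k j ≤ τbb * ωb ^ (k - j)) (hτbb : 0 ≤ τbb) (hωb : 0 ≤ ωb)
    (hqTb0 : ∀ k, 0 ≤ qTb k) (hqTbb : ∀ k, qTb k ≤ qbb)
    (hTcupb : ∀ g ∈ W, ∀ g' ∈ W, ∀ (k : ℕ) (y : ι),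
      |compProj Tb P k g (E g) y - compProj Tb P k g' (E g) y| ≤ wtb k y * (qTb k * |g k - g' k|))
    -- the COMMON output weight dominating both species' weights
    (hwa : ∀ k y, wta k y ≤ wt k y) (hwb : ∀ k y, wtb k y ≤ wt k y)
    -- g21's remaining binders at `T := (T_a + T_b) ∘ P` and at the sum letters (END-M, verbatim)
    (hfac : Factorises E W (compProj (Ta + Tb) P) Ψ) (hclip0 : ∀ k, 0 ≤ clip k)
    (hCup : ∀ g ∈ W, ∀ g' ∈ W, ∀ (k : ℕ) (U : Bg) (X : C.Dom), C.scale X = k + 1 → ∀ Q ∈ 𝒜 k, ∀ γ' ∈ G.vol X,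
      ‖act k (g k) U Q γ'‖ ≤ n k (g' k) U γ' ∧
        ‖act k (g k) U Q γ' - act k (g' k) U Q γ'‖ ≤ clip k * |g k - g' k| * n k (g' k) U γ')
    (hreprV : ∀ (k : ℕ) (s : ℝ) (Q : ι → ℝ) (U : Bg) (X : C.Dom),
      Ψ k s Q U X = (G.newTerm act k s U X (ρ k Q)).re - (G.newTerm act k s U₀ X (ρ k Q)).re + explZ k U X)
    (hclipb : ∀ k, clip k ≤ clipbar)
    (hK : TwoPointKP G W act 𝒜 n lip a d) (hdec : G.DecayExtract δ d) (hpin : G.PinBudget a δ (fun _ => B) κ)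
    (hρ : ∀ (k : ℕ) (Q Q' : ι → ℝ) (M : ℝ), (∀ y, |Q y - Q' y| ≤ wt k y * M) → ‖ρ k Q - ρ k Q'‖ ≤ M)
    (hexplZ : ∀ (k : ℕ) (U : Bg) (X : C.Dom), C.scale X = k + 1 → |explZ k U X| ≤ Real.exp (-(κ * C.d X)) * p₀ k)
    (hbase : ∀ g ∈ W, ∀ (U : Bg) (X : C.Dom), C.scale X = 0 → |E g U X| ≤ Real.exp (-(κ * C.d X)) * N 0)
    (hNsucc : ∀ j, p₀ j + 2 * B ≤ N (j + 1)) (hNnn : ∀ j, 0 ≤ N j)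
    (hbox : ∀ (k : ℕ) (Q : ι → ℝ),
      (∀ y, |Q y| ≤ wt k y * sizeRadius (fun k j => (1 + c) * (τa + τb) k j) N k) → ρ k Q ∈ 𝒜 k)
    (hB : 0 ≤ B) (hlipb : ∀ k, lip k ≤ lipbar)
    (hpos : 0 < max ωa ωb + 8 * lipbar * B * ((1 + c) * (τba + τbb))) :
    TermSize E W κ N ∧
      NE9 E W κ (prodModuli (8 * clipbar * B + 8 * lipbar * B * (qba + qbb))
        fun _ => max ωa ωb + 8 * lipbar * B * ((1 + c) * (τba + τbb))) ∧
        FadingMemory ((8 * clipbar * B + 8 * lipbar * B * (qba + qbb)) /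
            (max ωa ωb + 8 * lipbar * B * ((1 + c) * (τba + τbb))))
          (max ωa ωb + 8 * lipbar * B * ((1 + c) * (τba + τbb)))
          (prodModuli (8 * clipbar * B + 8 * lipbar * B * (qba + qbb))
            fun _ => max ωa ωb + 8 * lipbar * B * ((1 + c) * (τba + τbb))) := by
  -- the assembled S-binders and profile (leaf-07-g5's `NE9ChannelSum`, by name)
  have hadd := channelAdditive_add hadda haddb
  have hsum := channelStepSum_add hsuma hsumb
  have hstep := channelSizeAtStepNN_add hstepa hstepb hwa hwb (fun k j hjk => (hτa k j hjk).1) fun k j hjk => (hτb k j hjk).1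
  have hτ := profile_add hτa hτb hτba hτbb hωa.le hωb
  have hω : 0 ≤ max ωa ωb := hωa.le.trans (le_max_left _ _)
  -- the assembled coupling modulus (§1)
  have hTcup : ∀ g ∈ W, ∀ g' ∈ W, ∀ (k : ℕ) (y : ι),
      |compProj (Ta + Tb) P k g (E g) y - compProj (Ta + Tb) P k g' (E g) y| ≤ wt k y * ((qTa + qTb) k * |g k - g' k|) := by
    rw [compProj_add]
    exact tcup_add hTcupa hTcupb hwa hwb hqTa0 hqTb0
  exact ne9_and_fadingMemory_of_couplingTwoPoint_vacSub_sizeInduction_compProj G ρ U₀ explZ h0 hAdm hres hPadd hPcomm hPinto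
    hPsize hc hadd hsum hstep hfac hclip0 hCup (fun k => add_nonneg (hqTa0 k) (hqTb0 k)) hTcup hreprV hclipb
    (fun k => add_le_add (hqTab k) (hqTbb k)) hK hdec hpin hρ hexplZ hbase hNsucc hNnn hbox hB hlipb (add_nonneg hτba hτbb) hω
    hpos hτ

/-- **THE SAME WITH THE READ-OUT PROJECTION** `P := margProj r A` (c = cr·aA) — END-M's `…_margProj` BY NAME at the assembled
channel: RO/AW binders, `ProjInto` displayed (for classes of ANALYTIC families it is p213217 §2 `projInto_margProj_analytic`,
datum-free). [cite: Balaban1987RG1, (0.28)-(0.29) p.258, (1.3) p.260, (1.20)-(1.22) p.264] -/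
theorem termSize_ne9_and_fadingMemory_margProj_sum (G : ClusterGeom C) {Pot : Type*}
    [NormedAddCommGroup Pot] [NormedSpace ℂ Pot] {E : Functional C Bg} {W : Set (ℕ → ℝ)} {Adm MF : Set (Bg → C.Dom → ℝ)}
    {r : ℕ → (Bg → C.Dom → ℝ) → ℝ} {A : Bg → C.Dom → ℝ} {Ta Tb : ℕ → (ℕ → ℝ) → (Bg → C.Dom → ℝ) → ι → ℝ}
    {Ψ : ℕ → ℝ → (ι → ℝ) → Bg → C.Dom → ℝ} {act : ℕ → ℝ → Bg → Pot → G.P → ℂ} {𝒜 : ℕ → Set Pot}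
    {n : ℕ → ℝ → Bg → G.P → ℝ} {lip clip : ℕ → ℝ} {a d : G.P → ℝ} {δ : C.Dom → ℝ}
    {κ B lipbar clipbar qba qbb τba τbb ωa ωb cr aA : ℝ} {wt wta wtb : ℕ → ι → ℝ} {τa τb : ℕ → ℕ → ℝ}
    {qTa qTb p₀ N : ℕ → ℝ}
    (ρ : ℕ → (ι → ℝ) → Pot) (U₀ : Bg) (explZ : ℕ → Bg → C.Dom → ℝ) (h0 : ScaleZeroFree E W)
    (hAdm : AdmissibleTerms E W Adm) (hres : AdmRestrict Adm)
    -- the read-out, the marginal direction, the marginal-free class (END-M, verbatim)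
    (hrA : ReadAdditive Adm r) (hr0 : ReadZero r) (hrs : ReadSize Adm r κ cr) (hA : DirSize A κ aA) (hcr : 0 ≤ cr)
    (haA : 0 ≤ aA) (hPinto : ProjInto Adm MF (margProj r A))
    -- species (a)
    (hadda : ChannelAdditive MF Ta) (hsuma : ChannelStepSum MF Ta) (hstepa : ChannelSizeAtStepNN MF Ta κ wta τa)
    (hτa : ∀ k j, j ≤ k → 0 ≤ τa k j ∧ τa k j ≤ τba * ωa ^ (k - j)) (hτba : 0 ≤ τba) (hωa : 0 < ωa)
    (hqTa0 : ∀ k, 0 ≤ qTa k) (hqTab : ∀ k, qTa k ≤ qba)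
    (hTcupa : ∀ g ∈ W, ∀ g' ∈ W, ∀ (k : ℕ) (y : ι),
      |compProj Ta (margProj r A) k g (E g) y - compProj Ta (margProj r A) k g' (E g) y| ≤
        wta k y * (qTa k * |g k - g' k|))
    -- species (b)
    (haddb : ChannelAdditive MF Tb) (hsumb : ChannelStepSum MF Tb) (hstepb : ChannelSizeAtStepNN MF Tb κ wtb τb)
    (hτb : ∀ k j, j ≤ k → 0 ≤ τb k j ∧ τb k j ≤ τbb * ωb ^ (k - j)) (hτbb : 0 ≤ τbb) (hωb : 0 ≤ ωb)
    (hqTb0 : ∀ k, 0 ≤ qTb k) (hqTbb : ∀ k, qTb k ≤ qbb)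
    (hTcupb : ∀ g ∈ W, ∀ g' ∈ W, ∀ (k : ℕ) (y : ι),
      |compProj Tb (margProj r A) k g (E g) y - compProj Tb (margProj r A) k g' (E g) y| ≤
        wtb k y * (qTb k * |g k - g' k|))
    (hwa : ∀ k y, wta k y ≤ wt k y) (hwb : ∀ k y, wtb k y ≤ wt k y)
    (hfac : Factorises E W (compProj (Ta + Tb) (margProj r A)) Ψ) (hclip0 : ∀ k, 0 ≤ clip k)
    (hCup : ∀ g ∈ W, ∀ g' ∈ W, ∀ (k : ℕ) (U : Bg) (X : C.Dom), C.scale X = k + 1 → ∀ Q ∈ 𝒜 k, ∀ γ' ∈ G.vol X,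
      ‖act k (g k) U Q γ'‖ ≤ n k (g' k) U γ' ∧
        ‖act k (g k) U Q γ' - act k (g' k) U Q γ'‖ ≤ clip k * |g k - g' k| * n k (g' k) U γ')
    (hreprV : ∀ (k : ℕ) (s : ℝ) (Q : ι → ℝ) (U : Bg) (X : C.Dom),
      Ψ k s Q U X = (G.newTerm act k s U X (ρ k Q)).re - (G.newTerm act k s U₀ X (ρ k Q)).re + explZ k U X)
    (hclipb : ∀ k, clip k ≤ clipbar)
    (hK : TwoPointKP G W act 𝒜 n lip a d) (hdec : G.DecayExtract δ d) (hpin : G.PinBudget a δ (fun _ => B) κ)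
    (hρ : ∀ (k : ℕ) (Q Q' : ι → ℝ) (M : ℝ), (∀ y, |Q y - Q' y| ≤ wt k y * M) → ‖ρ k Q - ρ k Q'‖ ≤ M)
    (hexplZ : ∀ (k : ℕ) (U : Bg) (X : C.Dom), C.scale X = k + 1 → |explZ k U X| ≤ Real.exp (-(κ * C.d X)) * p₀ k)
    (hbase : ∀ g ∈ W, ∀ (U : Bg) (X : C.Dom), C.scale X = 0 → |E g U X| ≤ Real.exp (-(κ * C.d X)) * N 0)
    (hNsucc : ∀ j, p₀ j + 2 * B ≤ N (j + 1)) (hNnn : ∀ j, 0 ≤ N j)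
    (hbox : ∀ (k : ℕ) (Q : ι → ℝ),
      (∀ y, |Q y| ≤ wt k y * sizeRadius (fun k j => (1 + cr * aA) * (τa + τb) k j) N k) → ρ k Q ∈ 𝒜 k)
    (hB : 0 ≤ B) (hlipb : ∀ k, lip k ≤ lipbar)
    (hpos : 0 < max ωa ωb + 8 * lipbar * B * ((1 + cr * aA) * (τba + τbb))) :
    TermSize E W κ N ∧
      NE9 E W κ (prodModuli (8 * clipbar * B + 8 * lipbar * B * (qba + qbb))
        fun _ => max ωa ωb + 8 * lipbar * B * ((1 + cr * aA) * (τba + τbb))) ∧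
        FadingMemory ((8 * clipbar * B + 8 * lipbar * B * (qba + qbb)) /
            (max ωa ωb + 8 * lipbar * B * ((1 + cr * aA) * (τba + τbb))))
          (max ωa ωb + 8 * lipbar * B * ((1 + cr * aA) * (τba + τbb)))
          (prodModuli (8 * clipbar * B + 8 * lipbar * B * (qba + qbb))
            fun _ => max ωa ωb + 8 * lipbar * B * ((1 + cr * aA) * (τba + τbb))) :=
  termSize_ne9_and_fadingMemory_compProj_sum G ρ U₀ explZ h0 hAdm hres (projAdditive_margProj A hrA)
    (projScaleComm_margProj Adm A hr0) hPinto (projSize_margProj hrs hA hcr) (mul_nonneg hcr haA) hadda hsuma hstepa hτa hτba hωa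
    hqTa0 hqTab hTcupa haddb hsumb hstepb hτb hτbb hωb hqTb0 hqTbb hTcupb hwa hwb hfac hclip0 hCup hreprV hclipb hK hdec hpin hρ
    hexplZ hbase hNsucc hNnn hbox hB hlipb hpos

end End

end Summit.QuantumFields.BalabanUV.T4Continuum.NE9ChannelSumMargProj

end
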